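import Summits.NavierStokesRegularity.FunctionalMining.Candidates
import HarnessLib

/-!
# FunctionalMining — the strain-eigenvalue cores of K0 family `ES`, typed (dict seat, staged)

HONEST FRAMING. Search for candidate a priori estimates; no regularity claim. `dict/K0.json` family
`ES` has five cores × four exponents: `ES.absS.q` (`∫|S|^q`, typed in the staged `StrainMoment.lean`),
`ES.lam1.q` (`∫λ₁^q`), `ES.lam2p.q` (`∫(λ₂⁺)^q`), `ES.neglam3.q` (`∫(−λ₃)^q`), `ES.lamgeo.q`
(`∫|λ₁λ₂λ₃|^{q/3}`), where `λ₁ ≥ λ₂ ≥ λ₃` are the eigenvalues of the strain `S = ½(∇v + ∇vᵀ)`.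
This file gives the four eigenvalue cores Lean names WITHOUT a `card d = 3` binder in the
definitions (top = `⨆`, bottom = `⨅`, middle = trace − top − bottom, geometric = `|det S|^{1/card d}`),
and ONE generic rate shape `FunctionalRateSupBound Φ C` ("`dΦ/dt ≤ C‖ω‖_∞Φ` along classical
Navier–Stokes on `T³`", majorant form) of which the `T_C|C1` rows are instances. Nothing about
Navier–Stokes is proved here: the rows are `@[conjecture] def`s. STATUS (2026-08-22): the `lam1`
and `neglam3` rows are PROVED for every real `1 < q < ∞` downstream, in
`FunctionalMining/TopEigMomentRateSup.lean` (`TopEig.topEigMomentRateSupBound_of_one_lt`,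
`TopEig.negBotEigMomentRateSupBound_of_one_lt`: `∃ C ≥ 0`, by the CZ-closure N8 plus the coercivity
`|S| ≤ 6λ₁`, `|S| ≤ 6(−λ₃)` and a balance for the mollified convex spectral weight; prove seat gen 16,
DERIVATIVES §33) — superseding the earlier "sketch, UNREVIEWED" expectation recorded here;
`lam2p`, `lamgeo` are NOT coercive and N8 gives nothing — those remain the open `ES` rows. Proved
here: symmetry and trace of the strain matrix,
`∑ₖ λₖ = div v` (so `= 0` for divergence-free fields), non-negativity of the moments.
Mathlib API: `Matrix.IsHermitian.eigenvalues₀` (decreasing, `Fin (card d)`-indexed), `eigenvalues`,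
`trace_eq_sum_eigenvalues`. [ours, bookkeeping; cite: MillerARMA2020 for the eigenvalue framework, via
the tree's `Literature.Analysis.FluidPDE.MillerMiddleEigenvalueTorus`]
-/

noncomputable section

namespace Summit.NavierStokesRegularity.FunctionalMining

open MeasureTheory Set Literature.Analysis.FunctionSpaces Literature.Analysis.FluidPDE

variable {d : Type*} [Fintype d] [DecidableEq d]

/-! ### The strain matrix and its sorted eigenvalues -/

/-- The strain matrix `S(x)ᵢⱼ = ½((∂ⱼv(x))ᵢ + (∂ᵢv(x))ⱼ)` (the tree's convention in
`MiddleEigenvalueMomentRateBound`). [folklore] -/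
def torusStrainMatrix (v : UnitAddTorus d → EuclideanSpace ℝ d) (x : UnitAddTorus d) : Matrix d d ℝ :=
  Matrix.of fun i j => (Torus.partialDeriv j v x i + Torus.partialDeriv i v x j) / 2

/-- The strain matrix is symmetric. [folklore] -/
theorem torusStrainMatrix_isSymm (v : UnitAddTorus d → EuclideanSpace ℝ d) (x : UnitAddTorus d) :
    (torusStrainMatrix v x).IsSymm :=
  Matrix.IsSymm.ext fun i j => by simp only [torusStrainMatrix, Matrix.of_apply, add_comm]

/-- The strain matrix is symmetric, hence Hermitian over `ℝ`. [folklore] -/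
theorem torusStrainMatrix_isHermitian (v : UnitAddTorus d → EuclideanSpace ℝ d) (x : UnitAddTorus d) :
    (torusStrainMatrix v x).IsHermitian :=
  Matrix.isHermitian_iff_isSymm.mpr (torusStrainMatrix_isSymm v x)

/-- `tr S(x) = ∑ᵢ (∂ᵢv(x))ᵢ`. [folklore] -/
theorem torusStrainMatrix_trace (v : UnitAddTorus d → EuclideanSpace ℝ d) (x : UnitAddTorus d) :
    (torusStrainMatrix v x).trace = ∑ i, Torus.partialDeriv i v x i := by
  simp only [Matrix.trace, Matrix.diag, torusStrainMatrix, Matrix.of_apply]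
  exact Finset.sum_congr rfl fun i _ => by ring

/-- `tr S = div v` for `C¹` fields; in particular `tr S = 0` for divergence-free fields. [folklore] -/
theorem torusStrainMatrix_trace_eq_zero {v : UnitAddTorus d → EuclideanSpace ℝ d}
    (hv : Torus.IsSmooth v) (hdiv : Torus.IsDivFree v) (x : UnitAddTorus d) :
    (torusStrainMatrix v x).trace = 0 := by
  have hv1 : Torus.IsContDiff 1 v := hv.isContDiff (by simp)
  rw [torusStrainMatrix_trace, ← Torus.divergence_eq_sum_partialDeriv_apply hv1 x]
  exact hdiv x

/-- The sorted strain eigenvalues `λ₀ ≥ λ₁ ≥ … ` (Mathlib's decreasing `eigenvalues₀`, indexed by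
`Fin (Fintype.card d)`; at `card d = 3`: `λ₁ = · 0`, `λ₂ = · 1`, `λ₃ = · 2` in the fluid numbering).
[folklore] -/
def torusStrainEig (v : UnitAddTorus d → EuclideanSpace ℝ d) (x : UnitAddTorus d) :
    Fin (Fintype.card d) → ℝ :=
  (torusStrainMatrix_isHermitian v x).eigenvalues₀

/-- The ordered strain eigenvalues are antitone in the index. [folklore] -/
theorem torusStrainEig_antitone (v : UnitAddTorus d → EuclideanSpace ℝ d) (x : UnitAddTorus d) :
    Antitone (torusStrainEig v x) :=
  (torusStrainMatrix_isHermitian v x).eigenvalues₀_antitone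

/-- `∑ₖ λₖ(x) = tr S(x)`. [folklore; Mathlib `trace_eq_sum_eigenvalues`] -/
theorem sum_torusStrainEig (v : UnitAddTorus d → EuclideanSpace ℝ d) (x : UnitAddTorus d) :
    ∑ k, torusStrainEig v x k = (torusStrainMatrix v x).trace := by
  have h := (torusStrainMatrix_isHermitian v x).trace_eq_sum_eigenvalues
  rw [h]
  simp only [RCLike.ofReal_real_eq_id, id]
  exact (Fintype.sum_equiv (Fintype.equivOfCardEq (Fintype.card_fin _)).symm _ _ (fun i => rfl)).symm

/-- `∑ₖ λₖ = 0` for smooth divergence-free fields. [folklore] -/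
theorem sum_torusStrainEig_eq_zero {v : UnitAddTorus d → EuclideanSpace ℝ d}
    (hv : Torus.IsSmooth v) (hdiv : Torus.IsDivFree v) (x : UnitAddTorus d) :
    ∑ k, torusStrainEig v x k = 0 := by
  rw [sum_torusStrainEig, torusStrainMatrix_trace_eq_zero hv hdiv]

/-! ### The four eigenvalue densities (binder-free in `d`) -/

/-- `λ₁(x)` = the largest strain eigenvalue (`⨆` over the finite index; junk `0` if `d` is empty). -/
def torusStrainTopEig (v : UnitAddTorus d → EuclideanSpace ℝ d) (x : UnitAddTorus d) : ℝ :=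
  ⨆ k, torusStrainEig v x k

/-- `λ₃(x)` (at `card d = 3`) = the smallest strain eigenvalue. -/
def torusStrainBotEig (v : UnitAddTorus d → EuclideanSpace ℝ d) (x : UnitAddTorus d) : ℝ :=
  ⨅ k, torusStrainEig v x k

/-- `λ₂(x)` (at `card d = 3`) = `tr S − λ₁ − λ₃`, binder-free. -/
def torusStrainMidEig (v : UnitAddTorus d → EuclideanSpace ℝ d) (x : UnitAddTorus d) : ℝ :=
  (∑ k, torusStrainEig v x k) - torusStrainTopEig v x - torusStrainBotEig v x

/-- `|λ₁λ₂λ₃|^{1/3}(x)` (at `card d = 3`) = `|det S(x)|^{1/card d}`, binder-free. -/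
def torusStrainGeoEig (v : UnitAddTorus d → EuclideanSpace ℝ d) (x : UnitAddTorus d) : ℝ :=
  |(torusStrainMatrix v x).det| ^ ((Fintype.card d : ℝ)⁻¹)

/-- The geometric eigenvalue combination is non-negative. [folklore] -/
theorem torusStrainGeoEig_nonneg (v : UnitAddTorus d → EuclideanSpace ℝ d) (x : UnitAddTorus d) :
    0 ≤ torusStrainGeoEig v x :=
  Real.rpow_nonneg (abs_nonneg _) _

/-! ### The moments (K0 cores `ES.lam1.q`, `ES.lam2p.q`, `ES.neglam3.q`, `ES.lamgeo.q`) -/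

/-- `ES.lam1.q`: `∫ (λ₁⁺)^q` (`λ₁⁺ = λ₁` for trace-free `S` at `card d = 3`). [ours, bookkeeping] -/
def torusTopEigMoment (q : ℝ) (v : UnitAddTorus d → EuclideanSpace ℝ d) : ℝ :=
  ∫ x, (max (torusStrainTopEig v x) 0) ^ q

/-- `ES.lam2p.q`: `∫ (λ₂⁺)^q`. [ours, bookkeeping] -/
def torusMidEigPosMoment (q : ℝ) (v : UnitAddTorus d → EuclideanSpace ℝ d) : ℝ :=
  ∫ x, (max (torusStrainMidEig v x) 0) ^ q

/-- `ES.neglam3.q`: `∫ ((−λ₃)⁺)^q` (`= ∫ (−λ₃)^q` for trace-free `S` at `card d = 3`). [ours, bookkeeping] -/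
def torusNegBotEigMoment (q : ℝ) (v : UnitAddTorus d → EuclideanSpace ℝ d) : ℝ :=
  ∫ x, (max (-torusStrainBotEig v x) 0) ^ q

/-- `ES.lamgeo.q`: `∫ (|λ₁λ₂λ₃|^{1/3})^q`. [ours, bookkeeping] -/
def torusGeoEigMoment (q : ℝ) (v : UnitAddTorus d → EuclideanSpace ℝ d) : ℝ :=
  ∫ x, torusStrainGeoEig v x ^ q

/-- The top-eigenvalue moment is non-negative. [folklore] -/
theorem torusTopEigMoment_nonneg (q : ℝ) (v : UnitAddTorus d → EuclideanSpace ℝ d) :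
    0 ≤ torusTopEigMoment q v :=
  integral_nonneg fun _ => Real.rpow_nonneg (le_max_right _ _) _

/-- The positive-part middle-eigenvalue moment is non-negative. [folklore] -/
theorem torusMidEigPosMoment_nonneg (q : ℝ) (v : UnitAddTorus d → EuclideanSpace ℝ d) :
    0 ≤ torusMidEigPosMoment q v :=
  integral_nonneg fun _ => Real.rpow_nonneg (le_max_right _ _) _

/-- The negative-bottom-eigenvalue moment is non-negative. [folklore] -/
theorem torusNegBotEigMoment_nonneg (q : ℝ) (v : UnitAddTorus d → EuclideanSpace ℝ d) :
    0 ≤ torusNegBotEigMoment q v :=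
  integral_nonneg fun _ => Real.rpow_nonneg (le_max_right _ _) _

/-- The geometric-eigenvalue moment is non-negative. [folklore] -/
theorem torusGeoEigMoment_nonneg (q : ℝ) (v : UnitAddTorus d → EuclideanSpace ℝ d) :
    0 ≤ torusGeoEigMoment q v :=
  integral_nonneg fun x => Real.rpow_nonneg (torusStrainGeoEig_nonneg v x) _

/-! ### One rate shape for every `T_C|C1` row -/

/-- **`FunctionalRateSupBound Φ C` — the K0 shape `T_C` with multiplier `C1 = ‖ω‖_∞`, majorant form.**
For `d = 3`, along every classical solution of unforced Navier–Stokes/Euler (`ν ≥ 0`) on `[a, b]`,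
at every time `t` where `|ω(t, x)|² ≤ M²` for all `x` (`M ≥ 0`), every one-sided derivative value
`R` of `s ↦ Φ(u s)` within `[a, b]` at `t` satisfies `R ≤ C·M·Φ(u t)`. (The staged
`StrainMomentRateSupBound q C` is literally `FunctionalRateSupBound (torusStrainMoment q) C`; the
tree's `PalinstrophyRateSupBound C`, refuted for every `C` by p202516, has this shape with
`Φ = torusPalinstrophy`.) [ours, bookkeeping] -/
def FunctionalRateSupBound (Φ : (UnitAddTorus d → EuclideanSpace ℝ d) → ℝ) (C : ℝ) : Prop :=
  Fintype.card d = 3 → ∀ {ν : ℝ}, 0 ≤ ν → ∀ {a b : ℝ}, a < b →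
    ∀ {u : ℝ → UnitAddTorus d → EuclideanSpace ℝ d} {p : ℝ → UnitAddTorus d → ℝ},
      Torus.IsClassicalNSSolutionOn (Icc a b) ν 0 u p →
      ∀ t ∈ Icc a b, ∀ M : ℝ, 0 ≤ M → (∀ x, torusVorticitySqAt (u t) x ≤ M ^ 2) →
        ∀ R : ℝ, HasDerivWithinAt (fun s => Φ (u s)) R (Icc a b) t → R ≤ C * M * Φ (u t)

/-- Monotonicity of the shape in `C` for non-negative functionals. [ours, bookkeeping] -/
theorem FunctionalRateSupBound.mono {Φ : (UnitAddTorus d → EuclideanSpace ℝ d) → ℝ} {C C' : ℝ}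
    (h : FunctionalRateSupBound Φ C) (hΦ : ∀ v, 0 ≤ Φ v) (hCC' : C ≤ C') :
    FunctionalRateSupBound Φ C' := by
  intro hd ν hν a b hab u p hsol t ht M hM hMx R hR
  exact (h hd hν hab hsol t ht M hM hMx R hR).trans
    (mul_le_mul_of_nonneg_right (mul_le_mul_of_nonneg_right hCC' hM) (hΦ _))

/-- K0 row **`ES.lam1.q|T_C|C1`**: `d/dt ∫λ₁^q ≤ C‖ω‖_∞∫λ₁^q`. PROVED for every real `1 < q < ∞`
(`∃ C ≥ 0`): `TopEig.topEigMomentRateSupBound_of_one_lt` in `TopEigMomentRateSup.lean` (N8 CZ-closure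
+ coercivity `|S| ≤ 6λ₁` + mollified convex weight; 2026-08-22). The row itself stays a named `Prop`.
[ours] -/
@[conjecture] def TopEigMomentRateSupBound (q C : ℝ) : Prop :=
  FunctionalRateSupBound (d := d) (torusTopEigMoment q) C

/-- K0 row **`ES.lam2p.q|T_C|C1`**: `d/dt ∫(λ₂⁺)^q ≤ C‖ω‖_∞∫(λ₂⁺)^q`. NOT coercive (the moment can
vanish while `∫|S|^q` does not); N8 gives nothing — OPEN. [ours] -/
@[conjecture] def MidEigPosMomentRateSupBound (q C : ℝ) : Prop :=
  FunctionalRateSupBound (d := d) (torusMidEigPosMoment q) C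

/-- K0 row **`ES.neglam3.q|T_C|C1`**: `d/dt ∫(−λ₃)^q ≤ C‖ω‖_∞∫(−λ₃)^q`. PROVED for every real
`1 < q < ∞` (`∃ C ≥ 0`): `TopEig.negBotEigMomentRateSupBound_of_one_lt` in `TopEigMomentRateSup.lean`
(2026-08-22). The row itself stays a named `Prop`. [ours] -/
@[conjecture] def NegBotEigMomentRateSupBound (q C : ℝ) : Prop :=
  FunctionalRateSupBound (d := d) (torusNegBotEigMoment q) C

/-- K0 row **`ES.lamgeo.q|T_C|C1`**: `d/dt ∫|λ₁λ₂λ₃|^{q/3} ≤ C‖ω‖_∞∫|λ₁λ₂λ₃|^{q/3}`. NOT coercive;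
OPEN. [ours] -/
@[conjecture] def GeoEigMomentRateSupBound (q C : ℝ) : Prop :=
  FunctionalRateSupBound (d := d) (torusGeoEigMoment q) C

end Summit.NavierStokesRegularity.FunctionalMining

end
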